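import Literature.AlgebraicGeometry.ModuliOfAbelianVarieties.SiegelUniversalFamilyPullbackAdmissibleNormalForm
import Literature.AlgebraicGeometry.ModuliOfAbelianVarieties.SiegelTautologicalPeriodFamily
import Literature.Geometry.ComplexAnalytic.RelativeExponentialChartReframe
import HarnessLib

/-!
# ALIGN «RE-FRAMING A CHART OF THE PULLED-BACK UNIVERSAL FAMILY TO THE TAUTOLOGICAL PERIODS»: a relative exponential chart whose
# frames are admissible at period points `Z_t` is re-framed to period family `t ↦ Π_{Z_t}`, and `Z` is holomorphic
# ([BirkenhakeLange2004] §8.7 Lemma 8.7.1; [Lange2023AbelianVarietiesComplex] §7.1.2 Lemma 7.1.6 (2), §3.4.1 Prop. 3.4.1; [Shimura1963AnalyticFamilies] §2)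

Topic `Literature/AlgebraicGeometry/ModuliOfAbelianVarieties`; namespace `Literature.AlgebraicGeometry.ModuliOfAbelianVarieties`.
THEOREMS ONLY (no definition, no named fact, no instance, no notation, no `sorry`).  Cell `hodgecm-mathlib` (D-0151), FLOOR 0, P6 «MOD»
(crux hLiu418 = stmt-HodgeConjecture-24832, `--supports`), half A line L7 (socket `stub_UNIVFAM` of `Cruxes/HLiu418/Lines/F0_P6a_PELWitnessE.lean`
ED. 4 :655 = ★ P-3 `siegelUniversalFamilyUniformisation` → in-house), organ **O4 `stub_ALIGN`** of LA7-plan (g0)'s DEAL v1 (02:05:28Z), payer LA7-p01 (g0).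
Sequel of ★ ADM-NF `SiegelUniversalFamilyPullbackAdmissibleNormalForm` (p847727), over ★ TAUT-PERIOD `SiegelTautologicalPeriodFamily` (p847720) and
★ REFRAME `RelativeExponentialChartReframe` (p847723).  HC_CM is proved only modulo the printed citations (2 remaining named inputs hLiu418 24832,
h413 24833) until rung 0 closes; this file is generic and changes no count.

THE MATHEMATICS.  Let `(Φ₁, ex₁)` be a relative exponential chart (★ `IsRelExpChartOn`) of the analytic projection `P_T.A^an → T^an` over an
open `V`, and suppose that at every `t ∈ V` the frame `Φ₁ t : ℝ^{2g} ≃ ℂ^g` IS the complex coordinate of a marking of the fibre by `[J(Z_t), r₀]`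
with unit lattice frame (`m.γ = 1`, `m.Ψ = Φ₁ t`), `Z_t ∈ 𝔥_g` — the output of the FLATNESS organ O3.  The marking axiom `Ψ_J` says `Φ₁ t` is
`ℂ`-linear for the complex structure `J(Z_t)` of [Lange2023AbelianVarietiesComplex] Lemma 7.1.6 (2); so is the Siegel period isomorphism
`Π_{Z_t}(x, y) = Z_t x + Δ y` (★ `jMatrix_siegelPeriodEquiv`, diagram (7.3)).  Hence `C_t := Φ₁ t ∘ Π_{Z_t}⁻¹` is a `ℂ`-LINEAR automorphism of
`ℂ^g` (§1), with `C_t e_j = δ_j⁻¹ Φ₁ t (0, e_j)` — so `t ↦ C_t` is holomorphic, operator-valued (§2) — and `Z_t e_j = C_t⁻¹ (Φ₁ t (e_j, 0))`, so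
`Z` IS HOLOMORPHIC on `V` (§2; the Riemann-relation reading `Z = Δ Y⁻¹ X` of the frame matrix `(X | Y)`, [BirkenhakeLange2004] §8.7).  Re-framing
by `C` (★ `IsRelExpChartOn.reframe`, constant integral change of frame `T = 1`) gives the chart `ex (t, z) := ex₁ (t, C_t z)` with the TAUTOLOGICAL
period family `t ↦ Π_{Z_t}` (★ `SiegelModuli.exists_periodFamily_eq_siegelPeriodMap`), and every frame package for `ex₁` at `(Z_t, r)` (any `r`) becomes,
by ★ `SiegelAdelicMarking.exists_normalForm_of_γ_eq_one` (same torus map, same torsion parametrisation), a package for `ex` in P-3's NORMAL FORM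
`γ = 1`, `Ψ = Π_{Z_t}`, torus map `=` fibre map of `ex` (§3) — P-3's clauses (C), (G), (ADM) with `s` replaced by `Z`.

* §1 `exists_clm_comp_siegelPeriodMap_eq` — the `ℂ`-linear `C` with `C ∘ Π_Z = Ψ` for a `J(Z)`-linear frame `Ψ`; its values on the bases.
* §2 `exists_alignOperator` — along a chart: `C : MT → (ℂ^g →L[ℂ] ℂ^g)` holomorphic and bijective on `V` with `C_t ∘ Π_{Z_t} = Φ₁ t`;
  `mdifferentiableOn_Z_of_alignOperator` — `Z` is holomorphic on `V`.
* §3 **`exists_alignedChart_of_framePackages`** — THE HEAD (O4 `stub_ALIGN`).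

## References
* [BirkenhakeLange2004] C. Birkenhake, H. Lange, *Complex Abelian Varieties*, 2nd ed. (2004), §8.1 Prop. 8.1.1, §8.7 Lemma 8.7.1.
* [Lange2023AbelianVarietiesComplex] H. Lange, *Abelian Varieties over the Complex Numbers* (2023), §7.1.2 Lemma 7.1.6 (2) and (7.3); §3.4.1 Prop. 3.4.1 p. 186.
* [Shimura1963AnalyticFamilies] G. Shimura, *On analytic families of polarized abelian varieties and automorphic functions*, Ann. Math. 78 (1963), §2.
* [Milne2005ShimuraVarieties] J. S. Milne, *Introduction to Shimura Varieties* (2005), §6 Thm. 6.11.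
-/

set_option autoImplicit false

noncomputable section

open CategoryTheory CategoryTheory.Limits AlgebraicGeometry Matrix Topology Function
open scoped Manifold ContDiff Matrix.Norms.Elementwise
open Literature.AlgebraicGeometry.Motives (SchemeOver ComplexPoints AlgPoints specOver AbelianVariety CartierDivisor)
open Literature.AlgebraicGeometry.AbelianSchemes (PolarizedAbelianSchemeWithLevel AbelianSchemeOver)
open Literature.Geometry.Kaehler (ComplexTorus toComplexLinear)
open Literature.Geometry.Kaehler.ComplexTorus (proj cover)
open Literature.Geometry.ComplexAnalytic (IsRelExpChartOn totalOver basePoint)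
open Literature.NumberTheory.Transcendental (IsAnalytification)
open Literature.NumberTheory.Automorphic (siegelUpperHalfSpace)
open Literature.NumberTheory.Adeles

namespace Literature.AlgebraicGeometry.ModuliOfAbelianVarieties

open SiegelModuli (jOfSiegel)

variable {g : ℕ} {δ : Fin g → ℕ}

/-! ### §1 The `ℂ`-linear comparison `C ∘ Π_Z = Ψ` of a `J(Z)`-linear frame with the Siegel period isomorphism -/

/-- The Siegel period map on the second basis block: `Π_Z (0, e_j) = δ_j e_j`. [cite: BirkenhakeLange2004, §8.1 Prop. 8.1.1] -/
theorem siegelPeriodMap_inr_single (δ : Fin g → ℕ) (Z : Matrix (Fin g) (Fin g) ℂ) (j : Fin g) :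
    siegelPeriodMap δ Z (Sum.elim 0 (Pi.single j 1)) = (δ j : ℂ) • Pi.single j (1 : ℂ) := by
  classical
  funext i
  rw [siegelPeriodMap_apply, Pi.smul_apply, smul_eq_mul]
  simp only [Sum.elim_inl, Pi.zero_apply, Complex.ofReal_zero, mul_zero, Finset.sum_const_zero, zero_add,
    Sum.elim_inr, Pi.single_apply]
  split_ifs with h
  · subst h; simp
  · simp

/-- The Siegel period map on the first basis block: `Π_Z (e_j, 0) = Z e_j` (the `j`-th column of `Z`). [cite: BirkenhakeLange2004, §8.1 Prop. 8.1.1] -/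
theorem siegelPeriodMap_inl_single (δ : Fin g → ℕ) (Z : Matrix (Fin g) (Fin g) ℂ) (j : Fin g) :
    siegelPeriodMap δ Z (Sum.elim (Pi.single j 1) 0) = fun i => Z i j := by
  classical
  funext i
  rw [siegelPeriodMap_apply]
  simp only [Sum.elim_inr, Pi.zero_apply, Complex.ofReal_zero, mul_zero, add_zero, Sum.elim_inl, Pi.single_apply]
  rw [Finset.sum_eq_single j (fun j' _ hj' => by simp [hj']) (fun h => absurd (Finset.mem_univ j) h)]
  simp

/-- **The `ℂ`-linear comparison of a `J(Z)`-linear frame with the Siegel period isomorphism.**  For `Z ∈ 𝔥_g`, `δᵢ ≥ 1`, and a real frame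
`Ψ : ℝ^{2g} ≃ ℂ^g` which is `ℂ`-linear for `J(Z)` (`Ψ (J(Z) x) = i Ψ x` — the marking axiom `Ψ_J` at unit lattice frame), there is a BIJECTIVE
`ℂ`-linear `C : ℂ^g → ℂ^g` with `C ∘ Π_Z = Ψ`; necessarily `C e_j = δ_j⁻¹ Ψ (0, e_j)`.  (`Π_Z` is `ℂ`-linear for `J(Z)` by diagram (7.3), ★
`jMatrix_siegelPeriodEquiv`; `C := Ψ ∘ Π_Z⁻¹` commutes with `i`, ★ `toComplexLinear`.)
[cite: Lange2023AbelianVarietiesComplex, §7.1.2 Lemma 7.1.6 (2) and (7.3)] [cite: BirkenhakeLange2004, §8.1 Prop. 8.1.1] -/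
theorem exists_clm_comp_siegelPeriodMap_eq (hδ : ∀ i, 0 < δ i) {Z : Matrix (Fin g) (Fin g) ℂ} (hZ : Z ∈ siegelUpperHalfSpace g)
    (Ψ : (Fin g ⊕ Fin g → ℝ) ≃L[ℝ] (Fin g → ℂ)) (hΨJ : ∀ x, Ψ (jOfSiegel δ Z *ᵥ x) = Complex.I • Ψ x) :
    ∃ C : (Fin g → ℂ) →L[ℂ] (Fin g → ℂ), Bijective C ∧ (∀ x, C (siegelPeriodMap δ Z x) = Ψ x) ∧
      ∀ j, C (Pi.single j 1) = ((δ j : ℂ))⁻¹ • Ψ (Sum.elim 0 (Pi.single j 1)) := by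
  set Φ : (Fin g ⊕ Fin g → ℝ) ≃L[ℝ] (Fin g → ℂ) := siegelPeriodEquiv hδ hZ with hΦ
  have hΦJ : ∀ x : Fin g ⊕ Fin g → ℝ, Φ (jOfSiegel δ Z *ᵥ x) = Complex.I • Φ x := by
    intro x
    rw [← SiegelModuli.jMatrix_siegelPeriodEquiv hδ hZ, ComplexTorus.jMatrix_mulVec, ComplexTorus.apply_latticeJ]
  set C₀ : (Fin g → ℂ) ≃L[ℝ] (Fin g → ℂ) := Φ.symm.trans Ψ with hC₀
  have hC₀Φ : ∀ x, C₀ (Φ x) = Ψ x := fun x => by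
    rw [hC₀, ContinuousLinearEquiv.trans_apply, ContinuousLinearEquiv.symm_apply_apply]
  have hC₀I : ∀ u, (C₀ : (Fin g → ℂ) →L[ℝ] (Fin g → ℂ)) (Complex.I • u) = Complex.I • (C₀ : (Fin g → ℂ) →L[ℝ] (Fin g → ℂ)) u := by
    intro u
    obtain ⟨x, rfl⟩ := Φ.surjective u
    rw [ContinuousLinearEquiv.coe_coe, ← hΦJ, hC₀Φ, hC₀Φ, hΨJ]
  refine ⟨toComplexLinear (C₀ : (Fin g → ℂ) →L[ℝ] (Fin g → ℂ)) hC₀I, C₀.bijective, fun x => ?_, fun j => ?_⟩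
  · rw [Literature.Geometry.Kaehler.toComplexLinear_apply, ContinuousLinearEquiv.coe_coe, ← siegelPeriodEquiv_apply hδ hZ,
      hC₀Φ]
  · have hδj : (δ j : ℂ) ≠ 0 := Nat.cast_ne_zero.2 (hδ j).ne'
    have h := hC₀Φ (Sum.elim 0 (Pi.single j 1))
    rw [hΦ, ← (siegelPeriodEquiv hδ hZ).coe_coe] at h
    rw [Literature.Geometry.Kaehler.toComplexLinear_apply, ContinuousLinearEquiv.coe_coe]
    have h2 : siegelPeriodEquiv hδ hZ (Sum.elim 0 (Pi.single j 1)) = (δ j : ℂ) • Pi.single j (1 : ℂ) := by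
      rw [siegelPeriodEquiv_apply, siegelPeriodMap_inr_single]
    rw [ContinuousLinearEquiv.coe_coe, h2] at h
    -- `C₀ (δ_j • e_j) = Ψ (0, e_j)`; `C₀` is `ℂ`-linear
    have h3 : (toComplexLinear (C₀ : (Fin g → ℂ) →L[ℝ] (Fin g → ℂ)) hC₀I) ((δ j : ℂ) • Pi.single j (1 : ℂ)) =
        Ψ (Sum.elim 0 (Pi.single j 1)) := by
      rw [Literature.Geometry.Kaehler.toComplexLinear_apply, ContinuousLinearEquiv.coe_coe]; exact h
    rw [map_smul] at h3
    rw [← h3, smul_smul, inv_mul_cancel₀ hδj, one_smul, Literature.Geometry.Kaehler.toComplexLinear_apply,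
      ContinuousLinearEquiv.coe_coe]

/-- **At unit lattice frame the complex coordinate of a marking is `ℂ`-linear for the marking's complex structure**: `m.γ = 1` ⇒
`Ψ (J x) = i Ψ x` (the axiom `Ψ_J` with `γ⁻¹ = 1`). [cite: Milne2005ShimuraVarieties, §6 Thm. 6.11] [cite: LangeBirkenhake1992, §1.1.2] -/
theorem SiegelAdelicMarking.apply_mulVec_of_γ_eq_one {J : C0pm δ} {r : gspFinAdelic δ} {A : AbelianVariety ℂ}
    (m : SiegelAdelicMarking J r A) (hγ : m.γ = 1) (x : Fin g ⊕ Fin g → ℝ) :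
    m.Ψ ((J : Matrix (Fin g ⊕ Fin g) (Fin g ⊕ Fin g) ℝ) *ᵥ x) = Complex.I • m.Ψ x := by
  have h1 : (((m.γ⁻¹ : GL (Fin g ⊕ Fin g) ℚ) : Matrix (Fin g ⊕ Fin g) (Fin g ⊕ Fin g) ℚ).map (algebraMap ℚ ℝ)) = 1 := by
    rw [hγ, inv_one, Units.val_one]; exact Matrix.map_one _ (map_zero _) (map_one _)
  have h := m.Ψ_J x
  rw [h1, Matrix.one_mulVec, Matrix.one_mulVec] at h
  exact h

/-! ### §2 Along a chart: the holomorphic align operator `C_t ∘ Π_{Z_t} = Φ₁ t` and the holomorphy of `Z` -/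

section AlongChart

variable {EB : Type*} [NormedAddCommGroup EB] [NormedSpace ℂ EB] {B : Type*} [TopologicalSpace B] [ChartedSpace EB B]

/-- Finite sums of holomorphic vector-valued maps on a set are holomorphic there (plumbing). [folklore] -/
private theorem mdifferentiableOn_finset_sum {F : Type*} [NormedAddCommGroup F] [NormedSpace ℂ F] {κ : Type*}
    (t : Finset κ) {f : κ → B → F} {s : Set B}
    (hf : ∀ k ∈ t, MDifferentiableOn 𝓘(ℂ, EB) 𝓘(ℂ, F) (f k) s) :
    MDifferentiableOn 𝓘(ℂ, EB) 𝓘(ℂ, F) (fun b ↦ ∑ k ∈ t, f k b) s := by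
  classical
  induction t using Finset.induction_on with
  | empty => simpa using mdifferentiableOn_const
  | insert k t hk ih =>
    have h1 : MDifferentiableOn 𝓘(ℂ, EB) 𝓘(ℂ, F) (f k + fun b ↦ ∑ k ∈ t, f k b) s :=
      (hf k (Finset.mem_insert_self k t)).add (ih fun k' hk' ↦ hf k' (Finset.mem_insert_of_mem hk'))
    refine h1.congr fun b _ ↦ ?_
    simp [Finset.sum_insert hk]

/-- A family of continuous linear maps out of a finite-dimensional space is holomorphic as soon as all its values `b ↦ L b w` are
(expand in a basis). [folklore] -/
private theorem mdifferentiableOn_clm_of_apply {E E' : Type*} [NormedAddCommGroup E] [NormedSpace ℂ E] [NormedAddCommGroup E']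
    [NormedSpace ℂ E'] [FiniteDimensional ℂ E'] {L : B → (E' →L[ℂ] E)} {s : Set B}
    (hL : ∀ w, MDifferentiableOn 𝓘(ℂ, EB) 𝓘(ℂ, E) (fun b ↦ L b w) s) :
    MDifferentiableOn 𝓘(ℂ, EB) 𝓘(ℂ, E' →L[ℂ] E) L s := by
  classical
  set bE := Module.finBasis ℂ E' with hbE
  set co : Fin (Module.finrank ℂ E') → (E' →L[ℂ] ℂ) := fun i ↦ LinearMap.toContinuousLinearMap (bE.coord i)
    with hco
  have hsum : ∀ b, L b = ∑ i, ContinuousLinearMap.smulRightL ℂ E' E (co i) (L b (bE i)) := by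
    intro b
    ext w
    have happ : ∀ (f : Fin (Module.finrank ℂ E') → (E' →L[ℂ] E)) (v : E'), (∑ i, f i) v = ∑ i, f i v :=
      fun f v ↦ by simp
    rw [happ]
    simp only [ContinuousLinearMap.smulRightL_apply_apply, ContinuousLinearMap.smulRight_apply, hco,
      LinearMap.coe_toContinuousLinearMap', Module.Basis.coord_apply]
    conv_lhs => rw [← bE.sum_repr w]
    simp only [map_sum, map_smul]
  have hterm : ∀ i, MDifferentiableOn 𝓘(ℂ, EB) 𝓘(ℂ, E' →L[ℂ] E)
      (fun b ↦ ContinuousLinearMap.smulRightL ℂ E' E (co i) (L b (bE i))) s := fun i b hb ↦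
    ((ContinuousLinearMap.smulRightL ℂ E' E (co i)).differentiable.differentiableAt).comp_mdifferentiableWithinAt
      (hL (bE i) b hb)
  exact (mdifferentiableOn_finset_sum Finset.univ fun i _ ↦ hterm i).congr fun b _ ↦ hsum b

/-- **THE ALIGN OPERATOR ALONG A CHART.**  For a family of real frames `Φ₁ : B → (ℝ^{2g} ≃ ℂ^g)`, holomorphic on `V` (`b ↦ Φ₁ b x` holomorphic for
every `x` — the period clause of ★ `IsRelExpChartOn`), and period points `Z_b ∈ 𝔥_g` (`b ∈ V`) for which `Φ₁ b` is `ℂ`-linear w.r.t. `J(Z_b)`, there is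
`C : B → (ℂ^g →L[ℂ] ℂ^g)`, BIJECTIVE and with `C_b ∘ Π_{Z_b} = Φ₁ b` on `V`, and HOLOMORPHIC on `V` as an operator-valued map
(`C_b e_j = δ_j⁻¹ Φ₁ b (0, e_j)`).  [cite: BirkenhakeLange2004, §8.7 Lemma 8.7.1] [cite: Lange2023AbelianVarietiesComplex, §7.1.2 Lemma 7.1.6 (2), (7.3)] -/
theorem exists_alignOperator (hδ : ∀ i, 0 < δ i) {V : Set B} (Φ₁ : B → ((Fin g ⊕ Fin g → ℝ) ≃L[ℝ] (Fin g → ℂ)))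
    (hΦ₁ : ∀ x, MDifferentiableOn 𝓘(ℂ, EB) 𝓘(ℂ, Fin g → ℂ) (fun b => Φ₁ b x) V)
    (Z : B → Matrix (Fin g) (Fin g) ℂ) (hZ : ∀ b ∈ V, Z b ∈ siegelUpperHalfSpace g)
    (hJ : ∀ b ∈ V, ∀ x, Φ₁ b (jOfSiegel δ (Z b) *ᵥ x) = Complex.I • Φ₁ b x) :
    ∃ C : B → ((Fin g → ℂ) →L[ℂ] (Fin g → ℂ)),
      (∀ b ∈ V, Bijective (C b)) ∧ (∀ b ∈ V, ∀ x, C b (siegelPeriodMap δ (Z b) x) = Φ₁ b x) ∧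
      MDifferentiableOn 𝓘(ℂ, EB) 𝓘(ℂ, (Fin g → ℂ) →L[ℂ] (Fin g → ℂ)) C V := by
  classical
  have key : ∀ b, ∃ C : (Fin g → ℂ) →L[ℂ] (Fin g → ℂ), b ∈ V →
      (Bijective C ∧ (∀ x, C (siegelPeriodMap δ (Z b) x) = Φ₁ b x) ∧
        ∀ j, C (Pi.single j 1) = ((δ j : ℂ))⁻¹ • Φ₁ b (Sum.elim 0 (Pi.single j 1))) := by
    intro b
    by_cases hb : b ∈ V
    · obtain ⟨C, h1, h2, h3⟩ := exists_clm_comp_siegelPeriodMap_eq hδ (hZ b hb) (Φ₁ b) (hJ b hb)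
      exact ⟨C, fun _ => ⟨h1, h2, h3⟩⟩
    · exact ⟨0, fun h => absurd h hb⟩
  choose C hC using key
  refine ⟨C, fun b hb => (hC b hb).1, fun b hb => (hC b hb).2.1, ?_⟩
  -- holomorphy: on `V`, `C b w = Σ_j w_j δ_j⁻¹ Φ₁ b (0, e_j)`
  refine mdifferentiableOn_clm_of_apply fun w => ?_
  have hrepr : ∀ b ∈ V, (∑ j, w j • (((δ j : ℂ))⁻¹ • Φ₁ b (Sum.elim 0 (Pi.single j 1)))) = C b w := by
    intro b hb
    conv_rhs => rw [← (Pi.basisFun ℂ (Fin g)).sum_repr w]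
    simp only [map_sum, map_smul, Pi.basisFun_repr, Pi.basisFun_apply, (hC b hb).2.2]
  refine (mdifferentiableOn_finset_sum Finset.univ fun j _ => ?_).congr fun b hb => (hrepr b hb).symm
  exact ((hΦ₁ (Sum.elim 0 (Pi.single j 1))).const_smul ((δ j : ℂ))⁻¹).const_smul (w j)

/-- **THE PERIOD POINT IS HOLOMORPHIC ALONG THE CHART** (the Riemann-relation reading `Z = Δ Y⁻¹ X` of the frame): with `C` as in
`exists_alignOperator`, `Z_b e_j = C_b⁻¹ (Φ₁ b (e_j, 0))` on `V`, so every entry `b ↦ Z_b i j` is holomorphic on `V` (★ `mdifferentiableOn_inverse`).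
[cite: BirkenhakeLange2004, §8.7 Lemma 8.7.1] [cite: Shimura1963AnalyticFamilies, §2] -/
theorem mdifferentiableOn_siegelPoint_of_alignOperator {V : Set B} {Φ₁ : B → ((Fin g ⊕ Fin g → ℝ) ≃L[ℝ] (Fin g → ℂ))}
    (hΦ₁ : ∀ x, MDifferentiableOn 𝓘(ℂ, EB) 𝓘(ℂ, Fin g → ℂ) (fun b => Φ₁ b x) V)
    {Z : B → Matrix (Fin g) (Fin g) ℂ} {C : B → ((Fin g → ℂ) →L[ℂ] (Fin g → ℂ))}
    (hCb : ∀ b ∈ V, Bijective (C b)) (hCP : ∀ b ∈ V, ∀ x, C b (siegelPeriodMap δ (Z b) x) = Φ₁ b x)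
    (hC : MDifferentiableOn 𝓘(ℂ, EB) 𝓘(ℂ, (Fin g → ℂ) →L[ℂ] (Fin g → ℂ)) C V) (i j : Fin g) :
    MDifferentiableOn 𝓘(ℂ, EB) 𝓘(ℂ, ℂ) (fun b => Z b i j) V := by
  have hformula : ∀ b ∈ V, ((C b).inverse (Φ₁ b (Sum.elim (Pi.single j 1) 0))) i = Z b i j := by
    intro b hb
    rw [← hCP b hb, Literature.Geometry.ComplexAnalytic.IsRelExpChartOn.inverse_apply_of_bijective hCb hb,
      siegelPeriodMap_inl_single]
  have h1 : MDifferentiableOn 𝓘(ℂ, EB) 𝓘(ℂ, Fin g → ℂ)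
      (fun b => (C b).inverse (Φ₁ b (Sum.elim (Pi.single j 1) 0))) V :=
    (Literature.Geometry.ComplexAnalytic.IsRelExpChartOn.mdifferentiableOn_inverse hC hCb).clm_apply (hΦ₁ _)
  exact ((Literature.Geometry.Kaehler.mdifferentiableOn_pi_space (I := 𝓘(ℂ, EB))).1 h1 i).congr
    fun b hb => (hformula b hb).symm

end AlongChart

/-! ### §3 THE HEAD (O4 `stub_ALIGN`): the aligned chart of the pulled-back universal family -/

/-- **O4 `stub_ALIGN` — RE-FRAMING A CHART OF THE PULLED-BACK UNIVERSAL FAMILY TO THE TAUTOLOGICAL PERIODS.**  In the setting of ★ P-3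
`siegelUniversalFamilyUniformisation` (`𝓜`, a piece `ι_c : S_c → 𝓜 ⊗ ℂ`, `ψ : T → S_c`, `P := 𝓜.univ.baseChange (ψ ≫ ι_c ≫ pr)`, analytifications
`φT : MT → T(ℂ)`, `φA : MA → P.A(ℂ)`), let `(Φ₁, ex₁)` be a relative exponential chart of `basePoint hT P.A φA : MA → MT` over an open `V`, and
`Z : MT → M_g(ℂ)` with `Z t ∈ 𝔥_g` and `Φ₁ t` `ℂ`-LINEAR FOR `J(Z t)` at every `t ∈ V` (the output of the flatness organ O3: at every `t ∈ V` the frame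
`Φ₁ t` is the complex coordinate `m.Ψ` of a marking by `[J(Z t), r₀]` with `m.γ = 1` — ★ `SiegelAdelicMarking.apply_mulVec_of_γ_eq_one`).  THEN:
(i) every entry of `Z` is HOLOMORPHIC on `V`; (ii) there is a relative exponential chart `(Φ, ex)` of the same projection over `V` whose period family
is the TAUTOLOGICAL one `Φ t = Π_{Z t}` (`ex (t, z) = ex₁ (t, C_t z)`, ★ `IsRelExpChartOn.reframe`), such that (TRANSPORT) for every `r` and every
`t ∈ V`, an (ADM)-package of `P` at `φT t` for `(Z t, r)` whose marking has `γ = 1`, `Ψ = Φ₁ t` and torus map `=` the fibre map of `ex₁` yields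
P-3's clauses AT `t` for `ex`: (G) an additive analytification `ComplexTorus (Φ t) → A_t(ℂ)` reading `ex (t, ·)`, and (ADM) a package for `(Z t, r)`
in NORMAL FORM `γ = 1`, `Ψ = Π_{Z t}`, torus map `=` fibre map of `ex` (★ `SiegelAdelicMarking.exists_normalForm_of_γ_eq_one`: same torus map, same
torsion parametrisation) — token for token P-3's (G)∕(ADM) conjuncts with `s ↦ Z`, `U ↦ V`.
[cite: BirkenhakeLange2004, §8.7 Lemma 8.7.1; §8.1 Prop. 8.1.1] [cite: Lange2023AbelianVarietiesComplex, §3.4.1 Prop. 3.4.1 p. 186; §7.1.2 Lemma 7.1.6 (2)]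
[cite: Shimura1963AnalyticFamilies, §2] [cite: Milne2005ShimuraVarieties, §6 Thm. 6.11] -/
theorem exists_alignedChart_of_frameJLinear {N : ℕ} (hδ : IsPolarizationType δ) (𝓜 : SiegelFineModuliScheme g N δ)
    {Sc : SchemeOver ℂ} (ιc : Sc ⟶ (Motives.baseChange ℚ ℂ).obj 𝓜.M) (T : SchemeOver ℂ) (d : ℕ) (ψ : T ⟶ Sc)
    (MT : Type) [TopologicalSpace MT] [ChartedSpace (Fin d → ℂ) MT]
    (φT : MT → ComplexPoints T) (hT : IsAnalytification (Fin d → ℂ) T d φT)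
    (MA : Type) [TopologicalSpace MA] [ChartedSpace (Fin (d + g) → ℂ) MA]
    (φA : MA → ComplexPoints (totalOver T
      (𝓜.univ.baseChange (ψ.left ≫ ιc.left ≫ pullback.fst 𝓜.M.hom (Spec.map (CommRingCat.ofHom (algebraMap ℚ ℂ))))).A))
    (V : Set MT) (Φ₁ : MT → ((Fin g ⊕ Fin g → ℝ) ≃L[ℝ] (Fin g → ℂ))) (ex₁ : MT × (Fin g → ℂ) → MA)
    (hex₁ : IsRelExpChartOn (Fin d → ℂ) (Fin (d + g) → ℂ)
      (basePoint hT (𝓜.univ.baseChange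
        (ψ.left ≫ ιc.left ≫ pullback.fst 𝓜.M.hom (Spec.map (CommRingCat.ofHom (algebraMap ℚ ℂ))))).A φA) V Φ₁ ex₁)
    (Z : MT → Matrix (Fin g) (Fin g) ℂ) (hZ : ∀ t ∈ V, Z t ∈ siegelUpperHalfSpace g)
    (hJ : ∀ t ∈ V, ∀ x, Φ₁ t (jOfSiegel δ (Z t) *ᵥ x) = Complex.I • Φ₁ t x) :
    letI P := 𝓜.univ.baseChange (ψ.left ≫ ιc.left ≫ pullback.fst 𝓜.M.hom (Spec.map (CommRingCat.ofHom (algebraMap ℚ ℂ))))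
    (∀ i j, MDifferentiableOn 𝓘(ℂ, Fin d → ℂ) 𝓘(ℂ, ℂ) (fun t => Z t i j) V) ∧
    ∃ (Φ : MT → ((Fin g ⊕ Fin g → ℝ) ≃L[ℝ] (Fin g → ℂ))) (ex : MT × (Fin g → ℂ) → MA),
      (∀ t ∈ V, ∀ v : Fin g ⊕ Fin g → ℝ, Φ t v = siegelPeriodMap δ (Z t) v) ∧
      IsRelExpChartOn (Fin d → ℂ) (Fin (d + g) → ℂ) (basePoint hT P.A φA) V Φ ex ∧
      ∀ (r : gspFinAdelic δ) (t : MT) (ht : t ∈ V),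
        (∃ (m₁ : SiegelAdelicMarking ⟨jOfSiegel δ (Z t), SiegelComplexRecordSystem.jOfSiegel_mem_C0pm hδ.1 (hZ t ht)⟩ r
              (P.A.fibre (φT t).left).toAbelianVariety)
            (Θ : CartierDivisor (P.A.fibre (φT t).left).toAbelianVariety.X.left)
            (Λ : P.level.SymplecticLift (φT t).left Θ δ),
            Θ.IsAmple ∧ P.A.IsLambdaOfAt (φT t).left P.D P.pol.lam Θ ∧
            (∀ ⦃M : ℕ⦄, N ∣ M → M ≠ 0 → ∀ (x : Fin g ⊕ Fin g → ZMod M) (v : Fin g ⊕ Fin g → ℚ),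
              AdelicCongr ((r⁻¹ : gspFinAdelic δ) : GL (Fin g ⊕ Fin g) finAdeleQ) 1 v (fun i => ((x i).val : ℚ) / M) →
                ((Λ.lift M (Multiplicative.ofAdd x)) : (P.A.fibre (φT t).left).toAbelianVariety.Points ℂ) = m₁.r v) ∧
            m₁.γ = 1 ∧ (∀ v : Fin g ⊕ Fin g → ℝ, m₁.Ψ v = Φ₁ t v) ∧
            ∀ z : Fin g → ℂ, P.A.fibrePointToLeft (φT t).left (m₁.toFun (cover m₁.Ψ z)) = (φA (ex₁ (t, z))).left) →
        (∃ φt : ComplexTorus (Φ t) → (P.A.fibre (φT t).left).toAbelianVariety.Points ℂ,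
            IsAnalytification (Fin g → ℂ) (P.A.fibre (φT t).left).toAbelianVariety.X g φt ∧
            (∀ x y, φt (x + y) = φt x * φt y) ∧
            ∀ z : Fin g → ℂ, (φA (ex (t, z))).left = P.A.fibrePointToLeft (φT t).left (φt (cover (Φ t) z))) ∧
        (∃ (m : SiegelAdelicMarking ⟨jOfSiegel δ (Z t), SiegelComplexRecordSystem.jOfSiegel_mem_C0pm hδ.1 (hZ t ht)⟩ r
              (P.A.fibre (φT t).left).toAbelianVariety)
            (Θ : CartierDivisor (P.A.fibre (φT t).left).toAbelianVariety.X.left)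
            (Λ : P.level.SymplecticLift (φT t).left Θ δ),
            Θ.IsAmple ∧ P.A.IsLambdaOfAt (φT t).left P.D P.pol.lam Θ ∧
            (∀ ⦃M : ℕ⦄, N ∣ M → M ≠ 0 → ∀ (x : Fin g ⊕ Fin g → ZMod M) (v : Fin g ⊕ Fin g → ℚ),
              AdelicCongr ((r⁻¹ : gspFinAdelic δ) : GL (Fin g ⊕ Fin g) finAdeleQ) 1 v (fun i => ((x i).val : ℚ) / M) →
                ((Λ.lift M (Multiplicative.ofAdd x)) : (P.A.fibre (φT t).left).toAbelianVariety.Points ℂ) = m.r v) ∧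
            m.γ = 1 ∧ (∀ v : Fin g ⊕ Fin g → ℝ, m.Ψ v = siegelPeriodMap δ (Z t) v) ∧
            ∀ z : Fin g → ℂ, P.A.fibrePointToLeft (φT t).left (m.toFun (cover m.Ψ z)) = (φA (ex (t, z))).left) := by
  classical
  -- §2: the align operator and the holomorphy of `Z`
  obtain ⟨C, hCb, hCP, hC⟩ :=
    exists_alignOperator (EB := Fin d → ℂ) hδ.1 Φ₁ hex₁.mdifferentiableOn_period Z hZ hJ
  have hZhol : ∀ i j, MDifferentiableOn 𝓘(ℂ, Fin d → ℂ) 𝓘(ℂ, ℂ) (fun t => Z t i j) V :=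
    mdifferentiableOn_siegelPoint_of_alignOperator hex₁.mdifferentiableOn_period hCb hCP hC
  refine ⟨hZhol, ?_⟩
  -- the tautological period family along `Z` (★ TAUT-PERIOD)
  obtain ⟨Φ, hΦ, -⟩ :=
    SiegelModuli.exists_periodFamily_eq_siegelPeriodMap (I := 𝓘(ℂ, Fin d → ℂ)) hδ.1 hZ hZhol
  -- the re-framed chart (★ REFRAME, constant integral change of frame `T = 1`)
  have hframe : ∀ b ∈ V, ∀ x,
      Φ₁ b (((1 : Matrix (Fin g ⊕ Fin g) (Fin g ⊕ Fin g) ℤ).map (Int.cast : ℤ → ℝ)) *ᵥ x) = C b (Φ b x) := by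
    intro b hb x
    rw [Matrix.map_one _ Int.cast_zero Int.cast_one, Matrix.one_mulVec, hΦ b hb, hCP b hb]
  have hex : IsRelExpChartOn (Fin d → ℂ) (Fin (d + g) → ℂ) (basePoint hT _ φA) V Φ
      (fun q : MT × (Fin g → ℂ) => ex₁ (q.1, C q.1 q.2)) :=
    hex₁.reframe hC hCb (T := 1) (T' := (1 : Matrix (Fin g ⊕ Fin g) (Fin g ⊕ Fin g) ℤ)) (one_mul 1) hframe
  refine ⟨Φ, fun q => ex₁ (q.1, C q.1 q.2), hΦ, hex, fun r t ht hpk => ?_⟩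
  obtain ⟨m₁, Θ, Λ, hample, hlam, htower, hγ₁, hΨ₁, hjunc₁⟩ := hpk
  -- normal form of the marking: same torus map, same torsion parametrisation (★ ADM-NF §1)
  obtain ⟨m, hγ, hΨ, htoFun, hr⟩ := m₁.exists_normalForm_of_γ_eq_one hδ.1 (hZ t ht) hγ₁
  -- `Φ t = Π_{Z t} = m.Ψ` as continuous linear equivalences
  have hΦt : Φ t = m.Ψ := (SiegelModuli.periodFamily_eq_siegelPeriodEquiv hδ.1 hZ hΦ ht).trans hΨ.symm
  -- lattice coordinates agree: `Φ₁ t⁻¹ (C_t z) = Π_{Z t}⁻¹ z`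
  have hcoord : ∀ z, m₁.Ψ.symm (C t z) = m.Ψ.symm z := by
    intro z
    obtain ⟨x, rfl⟩ := m.Ψ.surjective z
    rw [ContinuousLinearEquiv.symm_apply_apply, hΨ, siegelPeriodEquiv_apply, hCP t ht, ← hΨ₁ x,
      ContinuousLinearEquiv.symm_apply_apply]
  -- the fibre map of the re-framed chart IS the torus map of the normal-form marking
  have hjunc : ∀ z, (𝓜.univ.baseChange (ψ.left ≫ ιc.left ≫ pullback.fst 𝓜.M.hom
        (Spec.map (CommRingCat.ofHom (algebraMap ℚ ℂ))))).A.fibrePointToLeft (φT t).left (m.toFun (cover m.Ψ z)) =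
      (φA (ex₁ (t, C t z))).left := by
    intro z
    have hcov : cover m.Ψ z = cover m₁.Ψ (C t z) := by
      show proj m.Ψ (m.Ψ.symm z) = proj m₁.Ψ (m₁.Ψ.symm (C t z))
      rw [hcoord]
      rfl
    rw [htoFun, hcov]
    exact hjunc₁ (C t z)
  refine ⟨?_, ⟨m, Θ, Λ, hample, hlam, fun M hNM hM y v hv => (htower hNM hM y v hv).trans (hr v).symm, hγ,
    fun v => by rw [hΨ, siegelPeriodEquiv_apply], hjunc⟩⟩
  -- (G): the torus map of the normal-form marking, read on `ComplexTorus (Φ t) = ComplexTorus m.Ψ`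
  rw [hΦt]
  have han : IsAnalytification (Fin g → ℂ) ((𝓜.univ.baseChange (ψ.left ≫ ιc.left ≫ pullback.fst 𝓜.M.hom
      (Spec.map (CommRingCat.ofHom (algebraMap ℚ ℂ))))).A.fibre (φT t).left).toAbelianVariety.X g m.toFun := by
    have h := m.isAnalytification
    rwa [m.dim_eq] at h
  exact ⟨m.toFun, han, m.toFun_add, fun z => (hjunc z).symm⟩

end Literature.AlgebraicGeometry.ModuliOfAbelianVarieties

end
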